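import Mathlib
import HarnessLib
import Summits.HubbardSuperconductivity.HubbardSuperconductivity.Theorems.KLProgrammeC4aPPKernelSplitProfile
import Summits.HubbardSuperconductivity.HubbardSuperconductivity.Theorems.KLProgrammeC4aBoxIntegralContinuity

/-!
# Route `KLProgramme` — crux C4a, S3 brick (B4) «(U1)-HYBRID» B-1 (v): THE TWO CUT-OFFS OF THE HYBRID SPLIT — a direct-caustic cut-off `c_d(ϑ,v)` and a Cooper-class
# cut-off `c_C(ϑ)`, smooth steps of `‖S(ϑ) − 2Φ(0,v+θ)‖²` and `‖S(ϑ)‖²`, with the null / support / size rows the three parts of `M₁` consume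

Cell `gate-hubbard-kl`, seat hubbard-kl-k3c3-p3 (g37; row «implicit-function / monotonicity route for μ(n)»).  Located definitions for the (C)-closer lane / the `M₁`
assembly (stub (C) `stub_twoLeg_curvature` of `KLRegimeEngineV17F2`, stmt-HubbardSuperconductivity-20437), memo HOME/hubbard-kl-k3c3-p3/U1-CAUSTIC-SUP.md §19–§20 (B-1).

WHY.  The first-order numerator `J·G` is split as `J·G = c_d c_C·J·G + (1 − c_d)·J·G + c_d(1 − c_C)·J·G`: the first piece is the umklapp numerator of
`…C4aUmkNumerator` / U7 (null within `τ₂/2` of the direct caustic and on the Cooper class `‖S‖ ≤ s₂/2`), the second the tangency part of D-2c / B-1(iii) (supported within `τ₂`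
of the direct caustic), the third the Cooper part of D-3d / B-1(iv) (supported in `‖S‖ ≤ s₂`).  With `κ_{t₁} = ppSplitProfile t₁` (`= 1` on `t ≤ t₁/2`, `= 0` on `t ≥ t₁`,
`|κ′| ≤ 6/t₁`; `…C4aPPKernelSplitProfile`):
* **`umkDirCut μ K ρ θ τ₂ ϑ v := 1 − κ_{τ₂²}(‖S(ϑ) − 2Φ(0,v+θ)‖²)`**, **`umkCooperCut μ K ρ θ s₂ ϑ := 1 − κ_{s₂²}(‖S(ϑ)‖²)`**, `S(ϑ) = pairSumPath μ K ρ ϑ θ 0`;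
* rows: values in `[0,1]`; `umkDirCut = 0` when `‖S − 2Φ(0,v+θ)‖ ≤ τ₂/2`, `= 1` when `τ₂ ≤ ‖S − 2Φ(0,v+θ)‖`; `umkCooperCut = 0` when `‖S‖ ≤ s₂/2`, `= 1` when `s₂ ≤ ‖S‖`;
  `C¹` (indeed `C^∞`) and `2π`-periodic in `v`, jointly continuous in `(ϑ, v)` / continuous in `ϑ`; **`abs_deriv_umkDirCut_le`**: `|∂_v c_d| ≤ 24·msD₁/τ₂` (the step's
  derivative lives where `‖S − 2Φ‖ < τ₂`); the split identity `umk_split`.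
Sizes binder shape; pure calculus on landed objects; nothing asserts (C), K3 or superconductivity.
References: FST II CPAM 51 (1998) §3 [cite: FeldmanSalmhoferTrubowitz1998]; BGM 2006 §2.4 [cite: BenfattoGiulianiMastropietro2006].
-/

noncomputable section

namespace Summit.HubbardSuperconductivity.HubbardSuperconductivity.Theorems.C4a

set_option linter.dupNamespace false -- summit = problem name (single-conjunct summit), D-0017

open Real Set Filter
open scoped Topology RealInnerProductSpace
open Literature.MathematicalPhysics.QuantumLattice Literature.MathematicalPhysics.QuantumLattice.BandSectorCounting Literature.Probability.LatticeModels
open Summit.HubbardSuperconductivity.HubbardSuperconductivity.Theorems.KLRegimeSplit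
open Summit.HubbardSuperconductivity.HubbardSuperconductivity.Theorems.DispersionFlow
open Summit.HubbardSuperconductivity.HubbardSuperconductivity.Theorems.PerturbedFermiCurve

/-- **The direct-caustic cut-off** `c_d(ϑ,v) = 1 − κ_{τ₂²}(‖S(ϑ) − 2Φ(0,v+θ)‖²)`: vanishes within `τ₂/2` of the direct caustic `2·FS`, equals `1` beyond `τ₂`. -/
def umkDirCut (μ : ℝ) (K : TrigPolyC4v) (ρ θ τ₂ ϑ v : ℝ) : ℝ :=
  1 - ppSplitProfile (τ₂ ^ 2) (‖pairSumPath μ K ρ ϑ θ 0 - (2 : ℝ) • levelPoint μ K 0 (v + θ)‖ ^ 2)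

/-- **The Cooper-class cut-off** `c_C(ϑ) = 1 − κ_{s₂²}(‖S(ϑ)‖²)`: vanishes on the Cooper class `‖S‖ ≤ s₂/2`, equals `1` beyond `s₂`. -/
def umkCooperCut (μ : ℝ) (K : TrigPolyC4v) (ρ θ s₂ ϑ : ℝ) : ℝ :=
  1 - ppSplitProfile (s₂ ^ 2) (‖pairSumPath μ K ρ ϑ θ 0‖ ^ 2)

/-! ## §1 Values, null and support rows, the split -/

/-- `0 ≤ c_d ≤ 1`. -/
theorem umkDirCut_mem_Icc (μ : ℝ) (K : TrigPolyC4v) (ρ θ τ₂ ϑ v : ℝ) : umkDirCut μ K ρ θ τ₂ ϑ v ∈ Icc (0 : ℝ) 1 := by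
  unfold umkDirCut
  have h0 := ppSplitProfile_nonneg (τ₂ ^ 2) (‖pairSumPath μ K ρ ϑ θ 0 - (2 : ℝ) • levelPoint μ K 0 (v + θ)‖ ^ 2)
  have h1 := ppSplitProfile_le_one (τ₂ ^ 2) (‖pairSumPath μ K ρ ϑ θ 0 - (2 : ℝ) • levelPoint μ K 0 (v + θ)‖ ^ 2)
  exact ⟨by linarith, by linarith⟩

/-- `0 ≤ c_C ≤ 1`. -/
theorem umkCooperCut_mem_Icc (μ : ℝ) (K : TrigPolyC4v) (ρ θ s₂ ϑ : ℝ) : umkCooperCut μ K ρ θ s₂ ϑ ∈ Icc (0 : ℝ) 1 := by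
  unfold umkCooperCut
  have h0 := ppSplitProfile_nonneg (s₂ ^ 2) (‖pairSumPath μ K ρ ϑ θ 0‖ ^ 2)
  have h1 := ppSplitProfile_le_one (s₂ ^ 2) (‖pairSumPath μ K ρ ϑ θ 0‖ ^ 2)
  exact ⟨by linarith, by linarith⟩

/-- **Null row of `c_d`** (U7's `hYnull` with `τ₁ = τ₂/2`): `‖S − 2Φ(0,v+θ)‖ ≤ τ₂/2 ⟹ c_d = 0`. -/
theorem umkDirCut_eq_zero {τ₂ : ℝ} (hτ₂ : 0 < τ₂) (μ : ℝ) (K : TrigPolyC4v) (ρ θ ϑ v : ℝ)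
    (h : ‖pairSumPath μ K ρ ϑ θ 0 - (2 : ℝ) • levelPoint μ K 0 (v + θ)‖ ≤ τ₂ / 2) : umkDirCut μ K ρ θ τ₂ ϑ v = 0 := by
  unfold umkDirCut
  rw [ppSplitProfile_eq_one_of_le (by positivity) ?_, sub_self]
  have h0 : 0 ≤ ‖pairSumPath μ K ρ ϑ θ 0 - (2 : ℝ) • levelPoint μ K 0 (v + θ)‖ := norm_nonneg _
  nlinarith

/-- **Support row of `1 − c_d`** (D-2c's `hcsupp`): `τ₂ ≤ ‖S − 2Φ(0,v+θ)‖ ⟹ c_d = 1`. -/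
theorem umkDirCut_eq_one {τ₂ : ℝ} (hτ₂ : 0 < τ₂) (μ : ℝ) (K : TrigPolyC4v) (ρ θ ϑ v : ℝ)
    (h : τ₂ ≤ ‖pairSumPath μ K ρ ϑ θ 0 - (2 : ℝ) • levelPoint μ K 0 (v + θ)‖) : umkDirCut μ K ρ θ τ₂ ϑ v = 1 := by
  unfold umkDirCut
  rw [ppSplitProfile_eq_zero_of_le (by positivity) ?_, sub_zero]
  nlinarith [norm_nonneg (pairSumPath μ K ρ ϑ θ 0 - (2 : ℝ) • levelPoint μ K 0 (v + θ))]

/-- **Null row of `c_C`** (U7's `hCnull` with `s₁ = s₂/2`): `‖S‖ ≤ s₂/2 ⟹ c_C = 0`. -/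
theorem umkCooperCut_eq_zero {s₂ : ℝ} (hs₂ : 0 < s₂) (μ : ℝ) (K : TrigPolyC4v) (ρ θ ϑ : ℝ) (h : ‖pairSumPath μ K ρ ϑ θ 0‖ ≤ s₂ / 2) :
    umkCooperCut μ K ρ θ s₂ ϑ = 0 := by
  unfold umkCooperCut
  rw [ppSplitProfile_eq_one_of_le (by positivity) ?_, sub_self]
  nlinarith [norm_nonneg (pairSumPath μ K ρ ϑ θ 0)]

/-- **Support row of `1 − c_C`** (D-3d's `hcsupp`): `s₂ ≤ ‖S‖ ⟹ c_C = 1`. -/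
theorem umkCooperCut_eq_one {s₂ : ℝ} (hs₂ : 0 < s₂) (μ : ℝ) (K : TrigPolyC4v) (ρ θ ϑ : ℝ) (h : s₂ ≤ ‖pairSumPath μ K ρ ϑ θ 0‖) :
    umkCooperCut μ K ρ θ s₂ ϑ = 1 := by
  unfold umkCooperCut
  rw [ppSplitProfile_eq_zero_of_le (by positivity) ?_, sub_zero]
  nlinarith [norm_nonneg (pairSumPath μ K ρ ϑ θ 0)]

/-- **The hybrid split of the numerator**: `X = c_d c_C·X + (1 − c_d)·X + c_d(1 − c_C)·X`. -/
theorem umk_split (cd cc X : ℝ) : X = cd * cc * X + (1 - cd) * X + cd * (1 - cc) * X := by ring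

/-! ## §2 Regularity in the loop angle and the derivative bound -/

section Sizes

variable {K : TrigPolyC4v} {A : ℝ} (hA : ∀ p : Momentum, ∀ j ≤ 2, ‖iteratedFDeriv ℝ j (frameShift K) p‖ ≤ A) (hA20 : A ≤ 1 / 20)
  (hd : klCurveD ≤ (bandBounds (show (-4 : ℝ) < -1.1 by norm_num) (show (-1.1 : ℝ) ≤ -0.1 by norm_num)
    (show (-0.1 : ℝ) < 0 by norm_num)).Dtmin - 2 * A)
  {μ r : ℝ} (hr : 0 < r) (hlo : (-1.1 : ℝ) < μ - r - A) (hhi : μ + r + A < -0.1)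
  {A₃ A₄ : ℝ} (hA₃ : ∀ p : Momentum, ‖iteratedFDeriv ℝ 3 (frameShift K) p‖ ≤ A₃)
  (hA₄ : ∀ p : Momentum, ‖iteratedFDeriv ℝ 4 (frameShift K) p‖ ≤ A₄)
include hA hA20 hd hr hlo hhi hA₃ hA₄

omit hA20 hA₃ hA₄ in
/-- The chord to the direct caustic, `v ↦ S − 2Φ(0,v+θ)`, is `C^∞` with derivative `−2·∂_sΦ(0,v+θ)`. -/
theorem hasDerivAt_dirChord (ρ ϑ θ v : ℝ) :
    HasDerivAt (fun x : ℝ => pairSumPath μ K ρ ϑ θ 0 - (2 : ℝ) • levelPoint μ K 0 (x + θ)) (-((2 : ℝ) • iteratedDeriv 1 (levelPoint μ K 0) (v + θ))) v := by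
  have h0 : |(0 : ℝ)| < r := by simpa using hr
  have hγ : HasDerivAt (fun x : ℝ => levelPoint μ K 0 (x + θ)) (iteratedDeriv 1 (levelPoint μ K 0) (v + θ)) v :=
    HasDerivAt.comp_add_const v θ (hasDerivAt_levelPoint_angle hA hd hlo hhi h0 (v + θ))
  exact (hγ.const_smul (2 : ℝ)).const_sub (pairSumPath μ K ρ ϑ θ 0)

omit hA20 hA₃ hA₄ in
/-- `c_d(ϑ,·)` is `C¹`. -/
theorem contDiff_umkDirCut (ρ θ τ₂ ϑ : ℝ) : ContDiff ℝ 1 (umkDirCut μ K ρ θ τ₂ ϑ) := by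
  have h0 : |(0 : ℝ)| < r := by simpa using hr
  have hP : ContDiff ℝ 1 (fun x : ℝ => pairSumPath μ K ρ ϑ θ 0 - (2 : ℝ) • levelPoint μ K 0 (x + θ)) :=
    contDiff_const.sub (((contDiff_levelPoint_of_sizes hA hd hlo hhi h0 1).comp (contDiff_id.add contDiff_const)).const_smul (2 : ℝ))
  have hsq : ContDiff ℝ 1 (fun x : ℝ => ‖pairSumPath μ K ρ ϑ θ 0 - (2 : ℝ) • levelPoint μ K 0 (x + θ)‖ ^ 2) := hP.norm_sq ℝ
  unfold umkDirCut
  exact contDiff_const.sub ((contDiff_ppSplitProfile (τ₂ ^ 2)).comp hsq)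

omit hA hA20 hd hr hlo hhi hA₃ hA₄ in
/-- `c_d` is `2π`-periodic in the loop angle. -/
theorem umkDirCut_periodic (μ : ℝ) (K : TrigPolyC4v) (ρ θ τ₂ ϑ v : ℝ) : umkDirCut μ K ρ θ τ₂ ϑ (v + 2 * π) = umkDirCut μ K ρ θ τ₂ ϑ v := by
  unfold umkDirCut
  rw [show v + 2 * π + θ = (v + θ) + 2 * π by ring, levelPoint_add_two_pi]

/-- **`|∂_v c_d| ≤ 24·msD₁/τ₂`** (`τ₂ > 0`, `|ρ| < r`): the step's derivative `κ′` (`|κ′| ≤ 6/τ₂²`) vanishes unless `‖S − 2Φ‖ < τ₂`, where `|∂_v‖S − 2Φ‖²| ≤ 2τ₂·2msD₁`. -/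
theorem abs_deriv_umkDirCut_le {τ₂ : ℝ} (hτ₂ : 0 < τ₂) (ρ θ ϑ v : ℝ) :
    |deriv (umkDirCut μ K ρ θ τ₂ ϑ) v| ≤ 24 * msD A₃ A₄ 1 / τ₂ := by
  have h0 : |(0 : ℝ)| < r := by simpa using hr
  set P : ℝ → Momentum := fun x => pairSumPath μ K ρ ϑ θ 0 - (2 : ℝ) • levelPoint μ K 0 (x + θ) with hP
  have hPd : HasDerivAt P (-((2 : ℝ) • iteratedDeriv 1 (levelPoint μ K 0) (v + θ))) v := hasDerivAt_dirChord hA hd hr hlo hhi ρ ϑ θ v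
  have hsq : HasDerivAt (fun x => ‖P x‖ ^ 2) (2 * ⟪P v, -((2 : ℝ) • iteratedDeriv 1 (levelPoint μ K 0) (v + θ))⟫) v := hPd.norm_sq
  have hκ : HasDerivAt (ppSplitProfile (τ₂ ^ 2)) (deriv (ppSplitProfile (τ₂ ^ 2)) (‖P v‖ ^ 2)) (‖P v‖ ^ 2) :=
    ((contDiff_ppSplitProfile (τ₂ ^ 2) (n := 1)).differentiable (by simp) _).hasDerivAt
  have hcomp := hκ.comp v hsq
  have hfun : umkDirCut μ K ρ θ τ₂ ϑ = fun x => (1 : ℝ) - (ppSplitProfile (τ₂ ^ 2) ∘ fun x => ‖P x‖ ^ 2) x := rfl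
  have hcut : HasDerivAt (umkDirCut μ K ρ θ τ₂ ϑ)
      (0 - deriv (ppSplitProfile (τ₂ ^ 2)) (‖P v‖ ^ 2) * (2 * ⟪P v, -((2 : ℝ) • iteratedDeriv 1 (levelPoint μ K 0) (v + θ))⟫)) v := by
    rw [hfun]; exact (hasDerivAt_const v (1 : ℝ)).sub hcomp
  rw [hcut.deriv, zero_sub, abs_neg, abs_mul]
  have hD1 : ‖iteratedDeriv 1 (levelPoint μ K 0) (v + θ)‖ ≤ msD A₃ A₄ 1 :=
    norm_iteratedDeriv_levelPoint_le hA hA20 hd hlo hhi hA₃ hA₄ h0 le_rfl (by norm_num) (v + θ)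
  have hM : 0 ≤ msD A₃ A₄ 1 := (norm_nonneg _).trans hD1
  by_cases hfar : τ₂ ^ 2 ≤ ‖P v‖ ^ 2
  · rw [deriv_ppSplitProfile_eq_zero_of_le (by positivity) hfar, abs_zero, zero_mul]; positivity
  · have hnear : ‖P v‖ < τ₂ := by
      by_contra h; exact hfar (pow_le_pow_left₀ hτ₂.le (le_of_not_gt h) 2)
    have h1 : |deriv (ppSplitProfile (τ₂ ^ 2)) (‖P v‖ ^ 2)| ≤ 6 / τ₂ ^ 2 := abs_deriv_ppSplitProfile_le (by positivity) _
    have h2 : |2 * ⟪P v, -((2 : ℝ) • iteratedDeriv 1 (levelPoint μ K 0) (v + θ))⟫| ≤ 2 * (τ₂ * (2 * msD A₃ A₄ 1)) := by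
      rw [abs_mul, abs_two]
      refine mul_le_mul_of_nonneg_left ((abs_real_inner_le_norm _ _).trans ?_) (by norm_num)
      rw [norm_neg, norm_smul, Real.norm_eq_abs, abs_two]
      exact mul_le_mul hnear.le (mul_le_mul_of_nonneg_left hD1 (by norm_num)) (by positivity) hτ₂.le
    calc |deriv (ppSplitProfile (τ₂ ^ 2)) (‖P v‖ ^ 2)| * |2 * ⟪P v, -((2 : ℝ) • iteratedDeriv 1 (levelPoint μ K 0) (v + θ))⟫|
        ≤ 6 / τ₂ ^ 2 * (2 * (τ₂ * (2 * msD A₃ A₄ 1))) := mul_le_mul h1 h2 (abs_nonneg _) (by positivity)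
      _ = 24 * msD A₃ A₄ 1 / τ₂ := by field_simp; ring

omit hA20 hA₃ hA₄ in
/-- `c_d` is jointly continuous in `(ϑ, v)` (`|ρ| < r`). -/
theorem continuous_umkDirCut₂ {ρ : ℝ} (hρ : |ρ| < r) (θ τ₂ : ℝ) : Continuous fun q : ℝ × ℝ => umkDirCut μ K ρ θ τ₂ q.1 q.2 := by
  have h0 : |(0 : ℝ)| < r := by simpa using hr
  have hS : Continuous fun q : ℝ × ℝ => pairSumPath μ K ρ q.1 θ 0 := (continuous_pairSumPath_angle hA hd hlo hhi hρ θ).comp continuous_fst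
  have hL' := (contDiff_levelPoint_of_sizes hA hd hlo hhi h0 0).continuous.comp (f := fun q : ℝ × ℝ => q.2 + θ) (continuous_snd.add continuous_const)
  have hL : Continuous fun q : ℝ × ℝ => levelPoint μ K 0 (q.2 + θ) := hL'.congr fun _ => rfl
  have hP' := (hS.sub (hL.const_smul (2 : ℝ))).norm
  have hP : Continuous fun q : ℝ × ℝ => ‖pairSumPath μ K ρ q.1 θ 0 - (2 : ℝ) • levelPoint μ K 0 (q.2 + θ)‖ ^ 2 := (hP'.pow 2).congr fun _ => rfl
  have hκ := ((contDiff_ppSplitProfile (τ₂ ^ 2) (n := 0)).continuous).comp hP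
  have hfun : (fun q : ℝ × ℝ => umkDirCut μ K ρ θ τ₂ q.1 q.2) =
      fun q => (1 : ℝ) - (ppSplitProfile (τ₂ ^ 2) ∘ fun q : ℝ × ℝ => ‖pairSumPath μ K ρ q.1 θ 0 - (2 : ℝ) • levelPoint μ K 0 (q.2 + θ)‖ ^ 2) q := rfl
  rw [hfun]
  exact continuous_const.sub hκ

omit hA20 hr hA₃ hA₄ in
/-- `c_C` is continuous in `ϑ` (`|ρ| < r`). -/
theorem continuous_umkCooperCut {ρ : ℝ} (hρ : |ρ| < r) (θ s₂ : ℝ) : Continuous (umkCooperCut μ K ρ θ s₂) := by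
  have hS' := (continuous_pairSumPath_angle hA hd hlo hhi hρ θ).norm
  have hS : Continuous fun ϑ : ℝ => ‖pairSumPath μ K ρ ϑ θ 0‖ ^ 2 := (hS'.pow 2).congr fun _ => rfl
  have hκ := ((contDiff_ppSplitProfile (s₂ ^ 2) (n := 0)).continuous).comp hS
  have hfun : umkCooperCut μ K ρ θ s₂ = fun ϑ => (1 : ℝ) - (ppSplitProfile (s₂ ^ 2) ∘ fun ϑ : ℝ => ‖pairSumPath μ K ρ ϑ θ 0‖ ^ 2) ϑ := rfl
  rw [hfun]
  exact continuous_const.sub hκ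

end Sizes

end Summit.HubbardSuperconductivity.HubbardSuperconductivity.Theorems.C4a

end
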